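/-
Copyright (c) 2026 the pub-hodgecm-mathlib formalisation cell (harness21).  Prover seat hodgecm-mathlib-K2Liu-p02 (g5), Track B «K2-LIT» ∕ hLiu418
#184♮, Road I v3: the witness input `Θ(Φ₁) ≠ 0` of ★ `K2LiuLineThetaNonvanishingOfThetaDist` for NON-NEGATIVE test functions (the Gaussian ⊗ lattice datum).  2026-09-04.
-/
import Literature.NumberTheory.Weil1964.AdelicThetaDistribution     -- ★ `thetaDist`, `thetaDistLM`, `summable_ratPt`, `ratPt_zero`
import HarnessLib

/-!
# K2_Liu road (hLiu418 = stmt-HodgeConjecture-24832): the adelic theta distribution does not vanish on a NON-NEGATIVE test function with a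
# positive value at the origin — `Re Θ(Φ) ≥ Re Φ(0) > 0`

Cell `pub/hodgecm-mathlib` (D-0151), Track B, build stream 29.  ★ `K2LiuLineThetaNonvanishingOfThetaDist.exists_fw_doubledLineThetaLift_sumTensor_conj_one_ne_zero(_curve)`
(organ U4b at a prescribed slot datum) takes ONE input about the slot datum `Φ₁`: `thetaDistLM … Φ₁ ≠ 0`.  For the datum the Road I v3 consumers want — the
SPHERICAL vector `Gaussian_∞ ⊗ 1_{lattice}` (SIGS-RoadI-v3 U4b, [KudlaRallis1994, §5]) — and more generally for every Schwartz–Bruhat function with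
NON-NEGATIVE REAL PARTS on the rational points and a POSITIVE real part at `0`, this input is elementary: the absolutely convergent series
`Θ(Φ) = Σ_{ξ ∈ F^ι} Φ(ξ)` (★ `Weil1964.summable_ratPt`) has real part `≥` its `ξ = 0` term (the argument of ★ `Weil1964.one_le_re_thetaDist_thetaWitness`, made
generic).

* `re_apply_zero_le_re_thetaDist` — `Re Φ(0) ≤ Re Θ(Φ)` for `Φ ∈ 𝒮(𝔸_F^ι)` with `∀ ξ, 0 ≤ Re Φ(ξ)`;
* `thetaDist_ne_zero_of_re_nonneg` ∕ **`thetaDistLM_ne_zero_of_re_nonneg`** — `Θ(Φ) ≠ 0` if moreover `0 < Re Φ(0)`.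

No definition, no instance, no named fact, no `sorry`; axioms ⊆ {propext, Classical.choice, Quot.sound}.  HONEST LABEL: HC_CM is proved only modulo the 7 printed citations
(2 remaining named inputs: hLiu418 = stmt-HodgeConjecture-24832, h413 = stmt-HodgeConjecture-24833) until rung 0 closes; `--supports stmt-HodgeConjecture-24832` helper,
count-neutral.

References: [Weil1964] A. Weil, *Sur certains groupes d'opérateurs unitaires*, Acta Math. 111 (1964), Chap. III n° 41 Thm 6 p. 193 (`Θ(Φ) = Σ_ξ Φ(ξ)`);
[KudlaRallis1994] S. Kudla, S. Rallis, Ann. of Math. 140 (1994) §5 (spherical Siegel–Weil sections).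
-/

set_option autoImplicit false
set_option linter.dupNamespace false

noncomputable section

open scoped BigOperators Topology
open NumberField IsDedekindDomain

namespace Summit.HodgeConjecture.HodgeConjecture.Cruxes.HLiu418.K2LiuThetaDistNonvanishingOfNonneg

open Literature.NumberTheory.Automorphic Literature.NumberTheory.Weil1964

variable {F : Type} [Field F] [NumberField F] {ι : Type} [Fintype ι]

/-- **`Re Φ(0) ≤ Re Θ(Φ)`** for a Schwartz–Bruhat `Φ` with non-negative real parts on the rational points: the series `Σ_ξ Φ(ξ)` converges absolutely
(★ `summable_ratPt`), its real part is the series of the (non-negative) real parts, which dominates its `ξ = 0` term.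
[cite: Weil1964, Chap. III n° 41, Thm 6 p. 193] -/
theorem re_apply_zero_le_re_thetaDist {Φ : (ι → AdeleRing (𝓞 F) F) → ℂ} (hΦ : Φ ∈ piSchwartzBruhat F ι)
    (hnn : ∀ ξ : ι → F, 0 ≤ (Φ (ratPt F ι ξ)).re) :
    (Φ 0).re ≤ (thetaDist F ι Φ).re := by
  have hs : Summable fun ξ : ι → F => Φ (ratPt F ι ξ) := summable_ratPt hΦ
  have hre : (thetaDist F ι Φ).re = ∑' ξ : ι → F, (Φ (ratPt F ι ξ)).re := by
    rw [thetaDist_def]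
    exact Complex.re_tsum hs
  rw [hre]
  have h0 : (Φ (ratPt F ι 0)).re = (Φ 0).re := by rw [ratPt_zero]
  rw [← h0]
  exact (Complex.reCLM.summable hs).le_tsum 0 fun ξ _ => hnn ξ

/-- **`Θ(Φ) ≠ 0`** for a Schwartz–Bruhat `Φ` with non-negative real parts on the rational points and `Re Φ(0) > 0` (e.g. a Gaussian times the indicator of a
lattice containing `0`). [cite: Weil1964, Chap. III n° 41, Thm 6 p. 193] [cite: KudlaRallis1994, §5] -/
theorem thetaDist_ne_zero_of_re_nonneg {Φ : (ι → AdeleRing (𝓞 F) F) → ℂ} (hΦ : Φ ∈ piSchwartzBruhat F ι)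
    (hnn : ∀ ξ : ι → F, 0 ≤ (Φ (ratPt F ι ξ)).re) (h0 : 0 < (Φ 0).re) : thetaDist F ι Φ ≠ 0 := by
  intro h
  have h1 := re_apply_zero_le_re_thetaDist hΦ hnn
  rw [h, Complex.zero_re] at h1
  exact absurd h1 (not_le.2 h0)

/-- **`Θ(Φ) ≠ 0` on the Schwartz–Bruhat submodule** (the input `hΦ₁` of ★ `K2LiuLineThetaNonvanishingOfThetaDist.exists_fw_doubledLineThetaLift_sumTensor_conj_one_ne_zero`):
non-negative real parts on the rational points and `Re Φ(0) > 0` suffice. [cite: Weil1964, Chap. III n° 41, Thm 6 p. 193] [cite: KudlaRallis1994, §5] -/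
theorem thetaDistLM_ne_zero_of_re_nonneg (Φ : piSchwartzBruhat F ι)
    (hnn : ∀ ξ : ι → F, 0 ≤ ((Φ : (ι → AdeleRing (𝓞 F) F) → ℂ) (ratPt F ι ξ)).re) (h0 : 0 < ((Φ : (ι → AdeleRing (𝓞 F) F) → ℂ) 0).re) :
    thetaDistLM F ι Φ ≠ 0 := by
  rw [thetaDistLM_apply]
  exact thetaDist_ne_zero_of_re_nonneg Φ.2 hnn h0

end Summit.HodgeConjecture.HodgeConjecture.Cruxes.HLiu418.K2LiuThetaDistNonvanishingOfNonneg

end
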